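import Literature.AnabelianGeometry.EtaleTheta.ThetaCoversAxioms
import Mathlib.GroupTheory.Commutator.Basic

/-!
# [EtTh] Remark 2.6.1 on the profinite side, I: the normalisers `N_{Π_C}(Π_{C̲}) = N_{Π_C}(Π_{C̲̲}) = Π_{C̲}`
# (proof-only companion)

Mochizuki, *The Étale Theta Function …* [EtTh], Publ. RIMS 45 (2009), §2, Remark 2.6.1, PRIMS text
p.40 (printed p.266; locators = PDF pages; bib key `MochizukiEtTh2009`): "Suppose … that `K` contains a
primitive `l`-th root of unity. Then … `Aut_K(X̲̲^log) = μ_l × {±1}` … `Aut_K(C̲̲^log) = μ_l`"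
[cite: MochizukiEtTh2009, Rmk 2.6.1 p.40].

Cell abc-iut, layer L2, discharge seat abc-iut-L2-d3 (node EtTh:Rmk2.6.1), companion of seat
abc-iut-L2-t2's `ThetaCovers.lean` / `ThetaCoversAxioms.lean` / `ThetaCoversTempered.lean`. For construction
data `(H' = Π_{C̲}, E, S, ι̲)` of `Π_{C̲̲} = ⟨S·E, ι̲⟩` (Def 2.3) over `X : CoverDataAx l` we PROVE, writing
`Π_{X̲̲} = S·E`, `Π_{X̲} = H' ∩ Π_X`:

* `inf_PiX_sup_zpowers_eq`, `sup_deltaX_eq_top`, `sup_eigen_sup_barTheta_eq'`,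
  `sup_zpowers_sup_barTheta_eq` — bookkeeping: `⟨Π_{X̲}, ι̲⟩ = Π_{C̲}`, `Π_{C̲}·Δ_X = Π_C`,
  `Π_{X̲̲}·Δ̄_Θ = Π_{X̲}`, `Π_{C̲̲}·Δ̄_Θ = Π_{C̲}`;
* `normalizer_eq_of_isTypeLTorsPm` — `N_{Π_C}(Π_{C̲}) = Π_{C̲}` (Rmk 2.1.1, from t2's `rmk211_holds`; the
  `CoverDataAx`-level form of abc-iut-L6-t23's `normalizer_PiCu_eq`);
* `normalizer_sup_zpowers_le` — `N_{Π_C}(Π_{C̲̲}) ⊆ Π_{C̲}` (unconditional) and `le_normalizer_sup_zpowers` —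
  `Π_{C̲} ⊆ N_{Π_C}(Π_{C̲̲})` under `μ_l ⊆ K` (`hmu`: `Π_C` acts trivially on `Δ̄_Θ`, the profinite form of
  t2's `HasMuL`): **`N_{Π_C}(Π_{C̲̲}) = Π_{C̲}`**;
* `le_normalizer_eigen` — `Π_{C̲} ⊆ N_{Π_C}(E)` for the eigenspace `E = Im(s_ι)` (Prop 2.2 (i)).

The companion `N_{Π_C}(Π_{X̲̲}) = Π_{C̲}` (which needs the printed definition of `Δ̄_Θ` and Prop 2.2 (iii)) is in
`Sec2AutKNormalizersX.lean`. No new definition, no named fact; nothing asserts that a `CoverDataAx` exists; no side is taken on any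
disputed claim.
-/

namespace Literature.AnabelianGeometry.EtaleTheta

namespace ThetaCovers

open scoped commutatorElement

universe u

/-! ### Two general normaliser inclusions -/

/-- `N(P) ⊆ N(P·M)` for `M` normal. [cite: MochizukiEtTh2009, Rmk 2.6.1 p.40] -/
theorem normalizer_le_normalizer_sup {G : Type*} [Group G] (P M : Subgroup G) [M.Normal] :
    Subgroup.normalizer (P : Set G) ≤ Subgroup.normalizer ((P ⊔ M : Subgroup G) : Set G) := by
  intro g hg
  rw [Subgroup.mem_normalizer_iff_map_conj_eq] at hg ⊢
  rw [Subgroup.map_sup, hg, Subgroup.Normal.map_conj_eq]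

/-- `N(P) ⊆ N(P ∩ M)` for `M` normal. [cite: MochizukiEtTh2009, Rmk 2.6.1 p.40] -/
theorem normalizer_le_normalizer_inf {G : Type*} [Group G] (P M : Subgroup G) [M.Normal] :
    Subgroup.normalizer (P : Set G) ≤ Subgroup.normalizer ((P ⊓ M : Subgroup G) : Set G) := by
  intro g hg
  rw [Subgroup.mem_normalizer_iff_map_conj_eq] at hg ⊢
  rw [Subgroup.map_inf _ _ _ (MulAut.conj g).injective, hg, Subgroup.Normal.map_conj_eq]

/-- A subgroup `K` normalises `P` as soon as conjugation by each `k ∈ K` maps `P` INTO `P` (apply it to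
`k⁻¹` for the converse inclusion). [cite: MochizukiEtTh2009, Rmk 2.6.1 p.40] -/
theorem le_normalizer_of_conj_mem {G : Type*} [Group G] {K P : Subgroup G}
    (h : ∀ k ∈ K, ∀ p ∈ P, k * p * k⁻¹ ∈ P) : K ≤ Subgroup.normalizer (P : Set G) :=
  Subgroup.le_normalizer_iff.mpr h

namespace CoverDataAx

variable {l : ℕ} (X : CoverDataAx.{u} l)

section Data

variable {H' E S : Subgroup X.PiC} {ι : X.PiC}

/-! ### Bookkeeping on the tower -/

/-- `⟨Π_{X̲}, ι̲⟩ = Π_{C̲}`: `Π_{X̲} = Π_{C̲} ∩ Π_X` has index `2` in `Π_{C̲}` and `ι̲ ∈ Π_{C̲} ∖ Π_X`.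
[cite: MochizukiEtTh2009, Def 2.1 p.36] -/
theorem inf_PiX_sup_zpowers_eq (hι : X.toCoverData.IsInversion H' ι) :
    (H' ⊓ X.PiX) ⊔ Subgroup.zpowers ι = H' := by
  refine le_antisymm (sup_le inf_le_left ((Subgroup.zpowers_le).mpr hι.mem)) fun x hx => ?_
  by_cases hxX : x ∈ X.PiX
  · exact Subgroup.mem_sup_left ⟨hx, hxX⟩
  · have hιinv : ι⁻¹ ∉ X.PiX := fun h => hι.not_mem ((Subgroup.inv_mem_iff _).mp h)
    have hιx : ι⁻¹ * x ∈ X.PiX :=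
      (Subgroup.mul_mem_iff_of_index_two X.index_PiX).mpr (iff_of_false hιinv hxX)
    have : x = ι * (ι⁻¹ * x) := by group
    rw [this]
    exact Subgroup.mul_mem _ (Subgroup.mem_sup_right (Subgroup.mem_zpowers ι))
      (Subgroup.mem_sup_left ⟨Subgroup.mul_mem _ (Subgroup.inv_mem _ hι.mem) hx, hιx⟩)

/-- `Π_{C̲}·Δ_X = Π_C` (`Π_{X̲}·Δ_X = Π_X` and `ι̲ ∉ Π_X`). [cite: MochizukiEtTh2009, Def 2.1 p.36] -/
theorem sup_deltaX_eq_top (hH' : X.toCoverData.IsTypeLTorsPm H') (hι : X.toCoverData.IsInversion H' ι) :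
    H' ⊔ X.DeltaX = ⊤ := by
  have hT := hH'.inf_isTypeLTors
  have hX : X.PiX ≤ H' ⊔ X.DeltaX := by
    rw [← hT.delta_sup]
    exact sup_le_sup_right inf_le_left _
  rw [eq_top_iff]
  intro x _
  by_cases hxX : x ∈ X.PiX
  · exact hX hxX
  · have hιinv : ι⁻¹ ∉ X.PiX := fun h => hι.not_mem ((Subgroup.inv_mem_iff _).mp h)
    have hιx : ι⁻¹ * x ∈ X.PiX :=
      (Subgroup.mul_mem_iff_of_index_two X.index_PiX).mpr (iff_of_false hιinv hxX)
    have : x = ι * (ι⁻¹ * x) := by group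
    rw [this]
    exact Subgroup.mul_mem _ (Subgroup.mem_sup_left hι.mem) (hX hιx)

/-- `(S·E)·Δ̄_Θ = Π_{X̲} = H' ∩ Π_X` (write `h = s·(s⁻¹h)` with `s ∈ S` over the same element of `G_K`,
`s⁻¹h ∈ Δ_{X̲} = E·Δ̄_Θ`). [cite: MochizukiEtTh2009, Prop 2.2 (ii) p.37] -/
theorem sup_eigen_sup_barTheta_eq' (hH' : X.toCoverData.IsTypeLTorsPm H')
    (hE : X.toCoverData.IsMinusEigen (H' ⊓ X.PiX) H' ι E) (hS : X.toCoverData.IsSplitting S) :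
    (S ⊔ E) ⊔ X.barTheta = H' ⊓ X.PiX := by
  haveI := X.barTheta_normal
  have hT := hH'.inf_isTypeLTors
  have hSle : S ≤ H' ⊓ X.PiX :=
    hS.le.trans (sup_le hT.Dx_le (X.barKer_le_barTheta.trans hT.barTheta_le))
  have hEle : E ≤ H' ⊓ X.PiX := hE.le.trans inf_le_left
  refine le_antisymm (sup_le (sup_le hSle hEle) hT.barTheta_le) fun h hh => ?_
  obtain ⟨⟨s, hs⟩, hsh⟩ := hS.surj (X.aug h)
  have hsh : X.aug s = X.aug h := hsh
  have hy : s⁻¹ * h ∈ E ⊔ X.barTheta := by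
    rw [hE.sup_eq]
    refine ⟨Subgroup.mul_mem _ (Subgroup.inv_mem _ (hSle hs)) hh, ?_⟩
    change s⁻¹ * h ∈ X.aug.ker
    rw [MonoidHom.mem_ker, map_mul, map_inv, hsh, inv_mul_cancel]
  have : h = s * (s⁻¹ * h) := by group
  rw [this]
  exact Subgroup.mul_mem _ (Subgroup.mem_sup_left (Subgroup.mem_sup_left hs))
    ((sup_assoc S E X.barTheta).symm ▸ Subgroup.mem_sup_right hy)

/-- `Π_{C̲̲}·Δ̄_Θ = Π_{C̲}`: `⟨S·E, ι̲⟩·Δ̄_Θ = ⟨(S·E)·Δ̄_Θ, ι̲⟩ = ⟨Π_{X̲}, ι̲⟩ = Π_{C̲}`.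
[cite: MochizukiEtTh2009, Def 2.3 p.38] -/
theorem sup_zpowers_sup_barTheta_eq (hH' : X.toCoverData.IsTypeLTorsPm H')
    (hι : X.toCoverData.IsInversion H' ι) (hE : X.toCoverData.IsMinusEigen (H' ⊓ X.PiX) H' ι E)
    (hS : X.toCoverData.IsSplitting S) :
    ((S ⊔ E) ⊔ Subgroup.zpowers ι) ⊔ X.barTheta = H' := by
  rw [sup_right_comm, X.sup_eigen_sup_barTheta_eq' hH' hE hS, X.inf_PiX_sup_zpowers_eq hι]

/-! ### `N_{Π_C}(Π_{C̲}) = Π_{C̲}` (Remark 2.1.1) -/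

/-- **`N_{Π_C}(Π_{C̲}) = Π_{C̲}`** for `Π_{C̲} = H'` of type `(1, l-tors)±` containing an inversion: "`C̲ → C`
fails to be Galois" (Rmk 2.1.1; t2's `rmk211_holds` gives `N(Π_{C̲}) ∩ Π_X = Π_{X̲}`, and `[Π_C : Π_X] = 2`).
[cite: MochizukiEtTh2009, Rmk 2.1.1 p.36] -/
theorem normalizer_eq_of_isTypeLTorsPm (hH' : X.toCoverData.IsTypeLTorsPm H')
    (hι : X.toCoverData.IsInversion H' ι) : Subgroup.normalizer (H' : Set X.PiC) = H' := by
  refine le_antisymm ?_ Subgroup.le_normalizer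
  have key := X.rmk211_holds H' hH'
  intro n hn
  by_cases hnX : n ∈ X.PiX
  · exact (key.le ⟨hn, hnX⟩).1
  · have hιinv : ι⁻¹ ∉ X.PiX := fun h => hι.not_mem ((Subgroup.inv_mem_iff _).mp h)
    have hιn : ι⁻¹ * n ∈ X.PiX :=
      (Subgroup.mul_mem_iff_of_index_two X.index_PiX).mpr (iff_of_false hιinv hnX)
    have hιN : ι⁻¹ ∈ Subgroup.normalizer (H' : Set X.PiC) :=
      Subgroup.inv_mem _ (Subgroup.le_normalizer hι.mem)
    have h2 : ι⁻¹ * n ∈ H' := (key.le ⟨Subgroup.mul_mem _ hιN hn, hιn⟩).1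
    have : n = ι * (ι⁻¹ * n) := by group
    rw [this]
    exact Subgroup.mul_mem _ hι.mem h2

/-! ### `N_{Π_C}(Π_{C̲̲}) = Π_{C̲}` -/

/-- `N_{Π_C}(Π_{C̲̲}) ⊆ Π_{C̲}` (unconditional): a normaliser of `Π_{C̲̲}` normalises `Π_{C̲̲}·Δ̄_Θ = Π_{C̲}`.
[cite: MochizukiEtTh2009, Rmk 2.6.1 p.40] -/
theorem normalizer_sup_zpowers_le (hH' : X.toCoverData.IsTypeLTorsPm H')
    (hι : X.toCoverData.IsInversion H' ι) (hE : X.toCoverData.IsMinusEigen (H' ⊓ X.PiX) H' ι E)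
    (hS : X.toCoverData.IsSplitting S) :
    Subgroup.normalizer (((S ⊔ E) ⊔ Subgroup.zpowers ι : Subgroup X.PiC) : Set X.PiC) ≤ H' := by
  haveI := X.barTheta_normal
  calc Subgroup.normalizer (((S ⊔ E) ⊔ Subgroup.zpowers ι : Subgroup X.PiC) : Set X.PiC)
      ≤ Subgroup.normalizer ((((S ⊔ E) ⊔ Subgroup.zpowers ι) ⊔ X.barTheta : Subgroup X.PiC) :
          Set X.PiC) := normalizer_le_normalizer_sup _ _
    _ = H' := by rw [X.sup_zpowers_sup_barTheta_eq hH' hι hE hS, X.normalizer_eq_of_isTypeLTorsPm hH' hι]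

/-- Under `μ_l ⊆ K` (`hmu`: `Π_C` centralises `Δ̄_Θ`), `Δ̄_Θ`-preimage normalises `S`, `E` and `⟨S·E, ι̲⟩`:
`t s t⁻¹ ∈ Ker·s ⊆ S`, `t e t⁻¹ ∈ Ker·e ⊆ E`, `t ι̲ t⁻¹ ∈ Ker·ι̲`. [cite: MochizukiEtTh2009, Rmk 2.6.1 p.40] -/
theorem barTheta_conj_mem (hmu : ∀ c : X.PiC, ∀ t ∈ X.barTheta, c * t * c⁻¹ * t⁻¹ ∈ X.barKer)
    {P : Subgroup X.PiC} (hP : X.barKer ≤ P) {t : X.PiC} (ht : t ∈ X.barTheta) {p : X.PiC} (hp : p ∈ P) :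
    t * p * t⁻¹ ∈ P := by
  have h1 : t * p * t⁻¹ * p⁻¹ ∈ X.barKer := by
    have := X.barKer.inv_mem (hmu p t ht)
    simpa [mul_assoc] using this
  have : t * p * t⁻¹ = (t * p * t⁻¹ * p⁻¹) * p := by group
  rw [this]
  exact Subgroup.mul_mem _ (hP h1) hp

/-- `Π_{C̲} ⊆ N_{Π_C}(Π_{C̲̲})` under `μ_l ⊆ K`: `Π_{C̲} = Π_{C̲̲}·Δ̄_Θ` and `Δ̄_Θ`-preimage normalises `Π_{C̲̲}`
(`Ker ⊆ S ⊆ Π_{C̲̲}`). Hence **`N_{Π_C}(Π_{C̲̲}) = Π_{C̲}`** and `Aut_K(C̲̲) = Π_{C̲}/Π_{C̲̲}`.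
[cite: MochizukiEtTh2009, Rmk 2.6.1 p.40] -/
theorem le_normalizer_sup_zpowers (hmu : ∀ c : X.PiC, ∀ t ∈ X.barTheta, c * t * c⁻¹ * t⁻¹ ∈ X.barKer)
    (hH' : X.toCoverData.IsTypeLTorsPm H') (hι : X.toCoverData.IsInversion H' ι)
    (hE : X.toCoverData.IsMinusEigen (H' ⊓ X.PiX) H' ι E) (hS : X.toCoverData.IsSplitting S) :
    H' ≤ Subgroup.normalizer (((S ⊔ E) ⊔ Subgroup.zpowers ι : Subgroup X.PiC) : Set X.PiC) := by
  have hK : X.barKer ≤ (S ⊔ E) ⊔ Subgroup.zpowers ι :=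
    hS.barKer_le.trans (le_sup_left.trans le_sup_left)
  conv_lhs => rw [← X.sup_zpowers_sup_barTheta_eq hH' hι hE hS]
  refine sup_le Subgroup.le_normalizer (le_normalizer_of_conj_mem fun t ht p hp => ?_)
  exact X.barTheta_conj_mem hmu hK ht hp

/-- `N_{Π_C}(Π_{C̲̲}) = Π_{C̲}` under `μ_l ⊆ K`. [cite: MochizukiEtTh2009, Rmk 2.6.1 p.40] -/
theorem normalizer_sup_zpowers_eq (hmu : ∀ c : X.PiC, ∀ t ∈ X.barTheta, c * t * c⁻¹ * t⁻¹ ∈ X.barKer)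
    (hH' : X.toCoverData.IsTypeLTorsPm H') (hι : X.toCoverData.IsInversion H' ι)
    (hE : X.toCoverData.IsMinusEigen (H' ⊓ X.PiX) H' ι E) (hS : X.toCoverData.IsSplitting S) :
    Subgroup.normalizer (((S ⊔ E) ⊔ Subgroup.zpowers ι : Subgroup X.PiC) : Set X.PiC) = H' :=
  le_antisymm (X.normalizer_sup_zpowers_le hH' hι hE hS) (X.le_normalizer_sup_zpowers hmu hH' hι hE hS)

/-! ### `Π_{C̲}` normalises the eigenspace `E` -/

/-- `Π_{C̲} ⊆ N_{Π_C}(E)`: `E = Im(s_ι)` is normalised by `Π_{X̲}` and by `ι̲` (Prop 2.2 (i)).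
[cite: MochizukiEtTh2009, Prop 2.2 (i) p.37] -/
theorem le_normalizer_eigen (hι : X.toCoverData.IsInversion H' ι)
    (hE : X.toCoverData.IsMinusEigen (H' ⊓ X.PiX) H' ι E) :
    H' ≤ Subgroup.normalizer ((E : Subgroup X.PiC) : Set X.PiC) := by
  conv_lhs => rw [← X.inf_PiX_sup_zpowers_eq hι]
  refine sup_le (le_normalizer_of_conj_mem fun g hg e he => hE.conj_mem g hg e he) ?_
  rw [Subgroup.zpowers_le, Subgroup.mem_normalizer_iff]
  intro e
  constructor
  · exact fun he => hE.iota_conj e he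
  · intro he
    -- `ι⁻¹ e' ι = ι (ι⁻² e' ι²) ι⁻¹` with `ι² ∈ Δ_{X̲}` normalising `E`
    have hι2 : ι * ι ∈ H' ⊓ X.PiX := by
      refine ⟨Subgroup.mul_mem _ hι.mem hι.mem, ?_⟩
      exact (Subgroup.mul_mem_iff_of_index_two X.index_PiX).mpr (iff_of_false hι.not_mem hι.not_mem)
    have h1 := hE.conj_mem _ (Subgroup.inv_mem _ hι2) _ he
    have h3 := hE.iota_conj _ h1
    have e3 : ι * ((ι * ι)⁻¹ * (ι * e * ι⁻¹) * (ι * ι)⁻¹⁻¹) * ι⁻¹ = e := by group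
    rwa [e3] at h3

end Data

end CoverDataAx

end ThetaCovers

end Literature.AnabelianGeometry.EtaleTheta
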